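import Mathlib.RingTheory.Polynomial.Pochhammer
import Literature.Computability.AlgebraicComplexity.DetInVP
import Literature.Computability.AlgebraicComplexity.HamiltonianCycleVNP
import Summits.ValiantsHypothesis.ValiantsHypothesis.Theorems.FermionicJetJetsInVNPCycles

/-!
# Route `FermionicJet`, item `JetsInVNP` (stmt-ValiantsHypothesis-5344) — helper file 2/3:
# the cycle-count gadgets (value at a permutation matrix, degree, circuit size)

Support lemmas (no new definitions) for the `VNP`-membership of the cycle jets `cycleJetPoly`.
For an `n × n` matrix `M` of polynomials — in the main file, the matrix of Boolean position
variables — the three gadgets of the `VP` witness are written out: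

* the RETURN polynomial `(M^m)_{ii}`;
* the INVERSE-LENGTH polynomial `∑_{m=1}^{n} (1/m) (M^m)_{ii} ∏_{1 ≤ l < m} (1 - (M^l)_{ii})`;
* the CYCLE COUNT `∑_i (inverse length of i)` and its BINOMIAL `(1/r!) ∏_{j<r} (count - j)`.

Under a `K`-algebra map `f` taking `M` entrywise to the permutation matrix of `σ`
(`f (M a b) = [σ a = b]`) they evaluate to `[σ^m i = i]`, `1/ℓ(i)`, `c(σ)` and `binom(c(σ), r)`
(`map_ret`, `map_invLen`, `map_cycles`, `map_choose`; first-return sum and `∑ᵢ 1/ℓ(i) = c(σ)` from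
helper file 1); if the entries of `M` have degree `≤ 1` the gadgets have degree `≤ m`, `≤ n + n²`,
`≤ n + n²`, `≤ r (n + n²)`; if the entries of `M` are free (`complexity = 0`) the gadgets have
circuit size `≤ 3(n+1)⁴` (`m ≤ n`), `≤ 7(n+1)⁶`, `≤ 8(n+1)⁷`, `≤ (10r+1)(n+1)⁷` — the return
polynomial being ONE instance `IMM_{n,m+1}(E_{ii}, M, …, M)` of iterated matrix multiplication
(`aeval_immPoly`, `complexity_immPoly_le`: `L(IMM_{N,d}) ≤ N + 2N³d`, with the substitution bound
`complexity_aeval_le`, exactly as `DetInVP.lean` computes Berkowitz's numbers `R M^q S`).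

References: P. Bürgisser, *Completeness and Reduction in Algebraic Complexity Theory*, Springer
2000, Def. 2.1–2.5, Rem. 2.7; M. Kumar, S. Saraf, SIAM J. Comput. 46 (2017), §3 (`IMM ∈ VP`).
-/

noncomputable section

-- single-conjunct layout: Sub = Summit, duplicated namespace component intended
set_option linter.dupNamespace false

namespace Summit.ValiantsHypothesis.ValiantsHypothesis.Theorems.FermionicJetJetsInVNP

open Literature.Computability.AlgebraicComplexity MvPolynomial Equiv Finset

universe u

/-! ### Values at a permutation matrix -/

section Eval

variable {K : Type u} [Field K] {τ τ' : Type*} {n : ℕ}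
  (f : MvPolynomial τ K →ₐ[K] MvPolynomial τ' K) (M : Matrix (Fin n) (Fin n) (MvPolynomial τ K))
  (σ : Perm (Fin n)) (hM : ∀ a b, f (M a b) = if σ a = b then 1 else 0)
include hM

/-- The return polynomial `(M^m)_{ii}` goes to `[σ^m i = i]`. [folklore] -/
theorem map_ret (m : ℕ) (i : Fin n) : f ((M ^ m) i i) = if (σ ^ m) i = i then 1 else 0 :=
  map_pow_apply_self_of_map_eq f.toRingHom M σ hM m i

/-- The inverse-length polynomial of `i` goes to `1/ℓ(i)` (first-return sum,
`sum_firstReturn`). [folklore] -/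
theorem map_invLen (i : Fin n) :
    f (∑ m ∈ Finset.Icc 1 n, C ((m : K)⁻¹) * (M ^ m) i i *
        ∏ l ∈ Finset.Ico 1 m, (1 - (M ^ l) i i)) =
      C ((Function.minimalPeriod σ i : K))⁻¹ := by
  simp only [map_sum, map_mul, map_prod, map_sub, map_one, map_ret f M σ hM, algHom_C,
    MvPolynomial.algebraMap_eq]
  have h := sum_firstReturn (R := MvPolynomial τ' K) σ i fun m => C ((m : K)⁻¹)
  rw [Fintype.card_fin] at h
  exact h

/-- The cycle-count polynomial goes to `c(σ)` (`∑ᵢ 1/ℓ(i) = c(σ)`, `sum_inv_minimalPeriod`).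
[folklore] -/
theorem map_cycles [CharZero K] :
    f (∑ i : Fin n, ∑ m ∈ Finset.Icc 1 n, C ((m : K)⁻¹) * (M ^ m) i i *
        ∏ l ∈ Finset.Ico 1 m, (1 - (M ^ l) i i)) = C ((σ.numCycles : K)) := by
  rw [map_sum]
  simp only [map_invLen f M σ hM]
  rw [← map_sum, sum_inv_minimalPeriod]

omit hM in
/-- `(1/r!) ∏_{j<r} (c - j) = binom(c, r)` in characteristic zero. [folklore] -/
theorem inv_factorial_mul_prod_sub (L : Type*) [Field L] [CharZero L] (c r : ℕ) :
    ((Nat.factorial r : L))⁻¹ * ∏ j ∈ Finset.range r, ((c : L) - j) = (c.choose r : L) := by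
  rw [← descPochhammer_eval_eq_prod_range, descPochhammer_eval_eq_descFactorial,
    Nat.descFactorial_eq_factorial_mul_choose, Nat.cast_mul, ← mul_assoc, inv_mul_cancel₀, one_mul]
  exact Nat.cast_ne_zero.2 (Nat.factorial_ne_zero r)

/-- The binomial polynomial goes to `binom(c(σ), r)`. [folklore] -/
theorem map_choose [CharZero K] (r : ℕ) :
    f (C ((Nat.factorial r : K))⁻¹ * ∏ j ∈ Finset.range r,
        ((∑ i : Fin n, ∑ m ∈ Finset.Icc 1 n, C ((m : K)⁻¹) * (M ^ m) i i *
          ∏ l ∈ Finset.Ico 1 m, (1 - (M ^ l) i i)) - C (j : K))) =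
      C ((σ.numCycles.choose r : K)) := by
  rw [map_mul, map_prod]
  simp only [map_sub, map_cycles f M σ hM, algHom_C, MvPolynomial.algebraMap_eq]
  rw [← inv_factorial_mul_prod_sub K σ.numCycles r, C_mul, map_prod]
  simp only [map_sub]

end Eval

/-! ### Degrees -/

section Degree

variable {K : Type u} [Field K] {τ : Type*} {n : ℕ} (M : Matrix (Fin n) (Fin n) (MvPolynomial τ K))
  (hdeg : ∀ a b, (M a b).totalDegree ≤ 1)
include hdeg

/-- Entries of `M^m` have degree `≤ m`. [folklore] -/
theorem totalDegree_pow_apply_le (m : ℕ) (a b : Fin n) : ((M ^ m) a b).totalDegree ≤ m := by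
  induction m generalizing a b with
  | zero =>
    rw [pow_zero, Matrix.one_apply]
    split_ifs
    · rw [totalDegree_one]
    · rw [totalDegree_zero]
  | succ m ih =>
    rw [pow_succ, Matrix.mul_apply]
    refine totalDegree_sum_le_of_le _ _ _ fun c _ => (totalDegree_mul _ _).trans ?_
    exact add_le_add (ih a c) (hdeg c b)

/-- The inverse-length polynomial has degree `≤ n + n²`. [folklore] -/
theorem totalDegree_invLen_le (i : Fin n) :
    (∑ m ∈ Finset.Icc 1 n, C ((m : K)⁻¹) * (M ^ m) i i *
        ∏ l ∈ Finset.Ico 1 m, (1 - (M ^ l) i i)).totalDegree ≤ n + n * n := by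
  refine totalDegree_sum_le_of_le _ _ _ fun m hm => ?_
  rw [Finset.mem_Icc] at hm
  refine (totalDegree_mul _ _).trans (add_le_add ((totalDegree_mul _ _).trans ?_) ?_)
  · rw [totalDegree_C, zero_add]
    exact (totalDegree_pow_apply_le M hdeg m i i).trans hm.2
  · refine (totalDegree_prod_le_of_le _ _ n fun l hl => ?_).trans ?_
    · rw [Finset.mem_Ico] at hl
      refine (totalDegree_sub _ _).trans (max_le ?_
        ((totalDegree_pow_apply_le M hdeg l i i).trans (by omega)))
      rw [totalDegree_one]; exact Nat.zero_le _
    · rw [Nat.card_Ico]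
      exact Nat.mul_le_mul_right n (by omega)

/-- The cycle-count polynomial has degree `≤ n + n²`. [folklore] -/
theorem totalDegree_cycles_le :
    (∑ i : Fin n, ∑ m ∈ Finset.Icc 1 n, C ((m : K)⁻¹) * (M ^ m) i i *
        ∏ l ∈ Finset.Ico 1 m, (1 - (M ^ l) i i)).totalDegree ≤ n + n * n :=
  totalDegree_sum_le_of_le _ _ _ fun i _ => totalDegree_invLen_le M hdeg i

/-- The binomial polynomial has degree `≤ r (n + n²)`. [folklore] -/
theorem totalDegree_choose_le (r : ℕ) :
    (C ((Nat.factorial r : K))⁻¹ * ∏ j ∈ Finset.range r,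
        ((∑ i : Fin n, ∑ m ∈ Finset.Icc 1 n, C ((m : K)⁻¹) * (M ^ m) i i *
          ∏ l ∈ Finset.Ico 1 m, (1 - (M ^ l) i i)) - C (j : K))).totalDegree ≤
      r * (n + n * n) := by
  refine (totalDegree_mul _ _).trans ?_
  rw [totalDegree_C, zero_add]
  refine (totalDegree_prod_le_of_le _ _ _ fun j _ => ?_).trans (by rw [Finset.card_range])
  refine (totalDegree_sub _ _).trans (max_le (totalDegree_cycles_le M hdeg) ?_)
  rw [totalDegree_C]; exact Nat.zero_le _

end Degree

/-! ### Circuit size -/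

section Size

variable {K : Type u} [Field K] {τ : Type*} {n : ℕ} (M : Matrix (Fin n) (Fin n) (MvPolynomial τ K))

/-- `n ^ a ≤ (n + 1) ^ b` for `a ≤ b`. [folklore] -/
theorem pow_le_pow_succ (n : ℕ) {a b : ℕ} (h : a ≤ b) : n ^ a ≤ (n + 1) ^ b :=
  (Nat.pow_le_pow_left (Nat.le_succ n) a).trans (Nat.pow_le_pow_right n.succ_pos h)

/-- `L(1 - g) ≤ L(g) + 2` (`1 - g = 1 + (-1) • g`). [folklore] -/
theorem complexity_one_sub_le' (g : MvPolynomial τ K) : complexity (1 - g) ≤ complexity g + 2 := by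
  have h1 := complexity_add_le_holds (1 : MvPolynomial τ K) (-g)
  have h2 := complexity_neg_le g
  have h3 : complexity (1 : MvPolynomial τ K) = 0 := by
    rw [← C_1]; exact complexity_C_holds _
  rw [sub_eq_add_neg]
  omega

/-- `L(g - C c) ≤ L(g) + 1`. [folklore] -/
theorem complexity_sub_C_le (g : MvPolynomial τ K) (c : K) :
    complexity (g - C c) ≤ complexity g + 1 := by
  have h1 := complexity_add_le_holds g (C (-c))
  have h2 := complexity_C_holds (σ := τ) (-c)
  rw [sub_eq_add_neg, ← map_neg]
  omega

/-- **`(M^m)_{ii} = IMM_{n,m+1}(E_{ii}, M, …, M)`**: the return polynomial is one instance of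
iterated matrix multiplication (`aeval_immPoly`; cf. `Berkowitz.berkNum_eq_aeval`). [folklore] -/
theorem aeval_single_immPoly (i : Fin n) (m : ℕ) :
    aeval (fun v : Fin (m + 1) × Fin n × Fin n => if (v.1 : ℕ) = 0 then
        Matrix.single i i (1 : MvPolynomial τ K) v.2.1 v.2.2 else M v.2.1 v.2.2)
      (immPoly n (m + 1) K) = (M ^ m) i i := by
  rw [aeval_immPoly, List.finRange_succ, List.map_cons, List.map_map, List.prod_cons]
  have htail : ((List.finRange m).map ((fun u : Fin (m + 1) => Matrix.of fun a b =>
      (if ((u, a, b) : Fin (m + 1) × Fin n × Fin n).1.val = 0 then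
        Matrix.single i i (1 : MvPolynomial τ K) a b else M a b)) ∘ Fin.succ)) =
      (List.finRange m).map fun _ => M := by
    refine List.map_congr_left fun u _ => Matrix.ext fun a b => ?_
    simp [Fin.succ_ne_zero]
  have hhead : (Matrix.of fun a b => (if ((0, a, b) : Fin (m + 1) × Fin n × Fin n).1.val = 0 then
      Matrix.single i i (1 : MvPolynomial τ K) a b else M a b)) = Matrix.single i i 1 := by
    refine Matrix.ext fun a b => ?_
    simp
  rw [htail, hhead, List.map_const', List.prod_replicate, List.length_finRange,
    Matrix.trace_single_mul, smul_eq_mul, one_mul]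

variable (hc : ∀ a b, complexity (M a b) = 0)
include hc

/-- **`L((M^m)_{ii}) ≤ n + 2n³(m+1)`** (`IMM ∈ VP`, `complexity_immPoly_le`, and the substitution
bound `complexity_aeval_le`; the substituted entries are free). [folklore] -/
theorem complexity_ret_le (i : Fin n) (m : ℕ) :
    complexity ((M ^ m) i i) ≤ n + 2 * n ^ 3 * (m + 1) := by
  rw [← aeval_single_immPoly M i m]
  refine (complexity_aeval_le _ _).trans ?_
  rw [Finset.sum_eq_zero, add_zero]
  · exact complexity_immPoly_le K n (m + 1)
  · intro v _
    split_ifs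
    · rw [Matrix.single_apply]
      split_ifs
      · rw [← C_1]; exact complexity_C_holds _
      · rw [← C_0]; exact complexity_C_holds _
    · exact hc _ _

/-- `L((M^m)_{ii}) ≤ 3 (n+1)⁴` for `m ≤ n`. [folklore] -/
theorem complexity_ret_le' (i : Fin n) {m : ℕ} (hm : m ≤ n) :
    complexity ((M ^ m) i i) ≤ 3 * (n + 1) ^ 4 := by
  refine (complexity_ret_le M hc i m).trans ?_
  have h1 : n ≤ (n + 1) ^ 4 := (pow_one n).symm.le.trans (pow_le_pow_succ n (by norm_num))
  have h2 : 2 * n ^ 3 * (m + 1) ≤ 2 * (n + 1) ^ 4 := by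
    calc 2 * n ^ 3 * (m + 1) ≤ 2 * (n + 1) ^ 3 * (n + 1) :=
          Nat.mul_le_mul (Nat.mul_le_mul_left 2 (Nat.pow_le_pow_left (Nat.le_succ n) 3))
            (by omega)
      _ = 2 * (n + 1) ^ 4 := by ring
  omega

/-- **The inverse-length polynomial has size `≤ 7 (n+1)⁶`** (`n` terms, each a product of `≤ n`
factors of size `≤ 3(n+1)⁴ + 2`). [folklore] -/
theorem complexity_invLen_le (i : Fin n) :
    complexity (∑ m ∈ Finset.Icc 1 n, C ((m : K)⁻¹) * (M ^ m) i i *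
        ∏ l ∈ Finset.Ico 1 m, (1 - (M ^ l) i i)) ≤ 7 * (n + 1) ^ 6 := by
  have hterm : ∀ m ∈ Finset.Icc 1 n, complexity (C ((m : K)⁻¹) * (M ^ m) i i *
      ∏ l ∈ Finset.Ico 1 m, (1 - (M ^ l) i i)) ≤ 6 * (n + 1) ^ 5 := by
    intro m hm
    rw [Finset.mem_Icc] at hm
    have h1 : complexity (C ((m : K)⁻¹) * (M ^ m) i i) ≤ 3 * (n + 1) ^ 4 + 1 := by
      have := complexity_mul_le_holds (C ((m : K)⁻¹)) ((M ^ m) i i)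
      have h0 := complexity_C_holds (σ := τ) ((m : K)⁻¹)
      have hr := complexity_ret_le' M hc i hm.2
      omega
    have h2 : complexity (∏ l ∈ Finset.Ico 1 m, (1 - (M ^ l) i i)) ≤
        n * (3 * (n + 1) ^ 4 + 2) + n := by
      refine (complexity_prod_le_of_le _ _ (3 * (n + 1) ^ 4 + 2) fun l hl => ?_).trans ?_
      · rw [Finset.mem_Ico] at hl
        exact (complexity_one_sub_le' _).trans
          (Nat.add_le_add_right (complexity_ret_le' M hc i (by omega)) 2)
      · rw [Nat.card_Ico]
        have : m - 1 ≤ n := by omega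
        gcongr
    have h3 := complexity_mul_le_holds (C ((m : K)⁻¹) * (M ^ m) i i)
      (∏ l ∈ Finset.Ico 1 m, (1 - (M ^ l) i i))
    have e1 : n * (3 * (n + 1) ^ 4 + 2) + n + 3 * (n + 1) ^ 4 = 3 * (n + 1) ^ 5 + 3 * n := by ring
    have e2 : n + 1 ≤ (n + 1) ^ 5 := (pow_one (n + 1)).symm.le.trans
      (Nat.pow_le_pow_right n.succ_pos (by norm_num))
    omega
  refine (complexity_sum_le_of_le _ _ _ hterm).trans ?_
  rw [Nat.card_Icc, Nat.add_sub_cancel]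
  have e1 : n * (6 * (n + 1) ^ 5) + n ≤ 6 * (n + 1) ^ 6 + (n + 1) ^ 6 := by
    have : n ≤ (n + 1) ^ 6 := (pow_one n).symm.le.trans (pow_le_pow_succ n (by norm_num))
    nlinarith
  omega

/-- **The cycle-count polynomial has size `≤ 8 (n+1)⁷`.** [folklore] -/
theorem complexity_cycles_le :
    complexity (∑ i : Fin n, ∑ m ∈ Finset.Icc 1 n, C ((m : K)⁻¹) * (M ^ m) i i *
        ∏ l ∈ Finset.Ico 1 m, (1 - (M ^ l) i i)) ≤ 8 * (n + 1) ^ 7 := by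
  refine (complexity_sum_le_of_le _ _ _ fun i _ => complexity_invLen_le M hc i).trans ?_
  rw [Finset.card_univ, Fintype.card_fin]
  have : n ≤ (n + 1) ^ 7 := (pow_one n).symm.le.trans (pow_le_pow_succ n (by norm_num))
  nlinarith

/-- **The binomial polynomial has size `≤ (10r+1) (n+1)⁷`.** [folklore] -/
theorem complexity_choose_le (r : ℕ) :
    complexity (C ((Nat.factorial r : K))⁻¹ * ∏ j ∈ Finset.range r,
        ((∑ i : Fin n, ∑ m ∈ Finset.Icc 1 n, C ((m : K)⁻¹) * (M ^ m) i i *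
          ∏ l ∈ Finset.Ico 1 m, (1 - (M ^ l) i i)) - C (j : K))) ≤
      (10 * r + 1) * (n + 1) ^ 7 := by
  have h1 : complexity (∏ j ∈ Finset.range r,
      ((∑ i : Fin n, ∑ m ∈ Finset.Icc 1 n, C ((m : K)⁻¹) * (M ^ m) i i *
        ∏ l ∈ Finset.Ico 1 m, (1 - (M ^ l) i i)) - C (j : K))) ≤
      r * (8 * (n + 1) ^ 7 + 1) + r := by
    refine (complexity_prod_le_of_le _ _ (8 * (n + 1) ^ 7 + 1) fun j _ => ?_).trans ?_
    · exact (complexity_sub_C_le _ _).trans (Nat.add_le_add_right (complexity_cycles_le M hc) 1)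
    · rw [Finset.card_range]
  have h2 := complexity_mul_le_holds (C ((Nat.factorial r : K))⁻¹)
    (∏ j ∈ Finset.range r, ((∑ i : Fin n, ∑ m ∈ Finset.Icc 1 n, C ((m : K)⁻¹) * (M ^ m) i i *
      ∏ l ∈ Finset.Ico 1 m, (1 - (M ^ l) i i)) - C (j : K)))
  have h3 := complexity_C_holds (σ := τ) ((Nat.factorial r : K)⁻¹)
  have e1 : 1 ≤ (n + 1) ^ 7 := Nat.one_le_pow _ _ n.succ_pos
  have e2 : (10 * r + 1) * (n + 1) ^ 7 = r * (8 * (n + 1) ^ 7) + 2 * r * (n + 1) ^ 7 +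
      (n + 1) ^ 7 := by ring
  nlinarith

end Size

end Summit.ValiantsHypothesis.ValiantsHypothesis.Theorems.FermionicJetJetsInVNP

end
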